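import Mathlib
import Summits.CriticalPhenomena.CardyFormulaZ2.Theorems.CardySelfRefinementDefs
import Summits.CriticalPhenomena.CardyFormulaZ2.Theorems.CardySelfRefinementTrivialSectorRateStubPivotalMassDictionary
import Summits.CriticalPhenomena.CardyFormulaZ2.Theorems.CardySelfRefinementTrivialSectorRateStubOrbitAlignmentConditioning
import HarnessLib

/-!
# Rate-free normalisation bound of the local engine (line `far-field-is-a-quarter-turn`, crux
`TrivialSectorRate`, stmt-CriticalPhenomena-10266), registered helper `localEngine_rateFree` of
the engine stub `stub_localEngine`

The CONDITIONAL version of the block-mass dictionary of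
`CardySelfRefinementTrivialSectorRateStubPivotalMassDictionary` (`Piv_le_real_Rel`).  Fix a set of
coins `K` (in the registered statement: the coins read inside the `R`-box about the block centre
`k•u`), a far field `S \ K`, and let `ν` be the law of the configuration inside `K`
(`(coinLaw k q).map (· ∩ K)`); the engine works with the conditional influences
`ν{T | insert i (T ∪ (S \ K)) ∈ E} − ν{T | (T ∪ (S \ K)) \ {i} ∈ E}` of the block coins `i` on the
pulled-back localised crossing event `E = coinEvent k m F η`.

* `abs_cond_infl_le_real_Rel` — for EVERY finite measure `ν` on coin sets, every far field `L` and
  every coin `i` read inside the `k`-box about `k•u`: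
  `|ν{insert i (T ∪ L) ∈ E} − ν{(T ∪ L) \ {i} ∈ E}| ≤ ν{T | cfg k (T ∪ L) ∈ Rel k m F η u k}`:
  the two events differ only where the coin `i` is pivotal at the configuration `T ∪ L`
  (`abs_measureReal_sub_le_measureReal_symmDiff`), and there the edges reading `i`, hence the
  `k`-box, are set-pivotal for `Aloc` (`isPivotalOn_cfg_of_not_iff`);
* `abs_orbit_comb_le_of_abs_le` — the bookkeeping `|a₂ · ½X − a₁ · ¼Y| ≤ (2|a₂| + κ|a₁|) ρ` from
  `|X| ≤ 4ρ`, `|Y| ≤ 4κρ`;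
* `abs_orbit_comb_cond_le_real_Rel` — the bound for a general finite `ν` and far field `L`
  (`≤ 4` selector coins, `≤ 4 · 2k²` interior coins: `card_bundlesAt_le`, `card_cellsAt_le`,
  `card_interiorEdges_le`);
* **`localEngine_rateFree`** (registered signature) — the case `L = S \ K`,
  `K = coinWindow k (boxEdgesAt (ctr k u) R)`, `ν = (coinLaw k q).map (· ∩ K)`.
-/

noncomputable section

namespace Summit.CriticalPhenomena.CardyFormulaZ2.Theorems.CardySelfRefinement.FarField

open scoped Topology symmDiff
open Filter Set MeasureTheory
open Literature.Probability.LatticeModels Literature.Probability.Percolation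
open Literature.Probability.Percolation.QuadCrossing
open Summit.CriticalPhenomena.CardyFormulaZ2.Theses.CardySelfRefinement

/-! ## Conditional influence ≤ conditional relevance -/

/-- Adjoining a fixed far field `L` is a measurable self-map `T ↦ T ∪ L` of the coin space
(coordinatewise `or` with a constant). -/
theorem measurable_union_const_far {ι : Type*} (L : Set ι) : Measurable fun T : Set ι => T ∪ L :=
  measurable_set_iff.2 fun i => (measurable_set_mem i).or measurable_const

/-- **Conditional influence ≤ conditional set-pivotality of the `k`-box.**  For every finite measure
`ν` on coin sets, every far field `L`, and every coin `i` all of whose reading edges lie in the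
lattice box of radius `k` about `k•u`:
`|ν{T | insert i (T ∪ L) ∈ E} − ν{T | (T ∪ L) \ {i} ∈ E}| ≤ ν{T | cfg k (T ∪ L) ∈ Rel k m F η u k}`
(`E = coinEvent k m F η`, `η ≠ 0` for measurability): a point of the symmetric difference of the two
events is a configuration `T ∪ L` at which flipping `i` changes the outcome, so the edges reading `i`
are set-pivotal for `Aloc` at `cfg k (T ∪ L)` (`isPivotalOn_cfg_of_not_iff`), hence so is the box. -/
theorem abs_cond_infl_le_real_Rel (k m : ℕ) (F : Fin m → Quad (univ : Set ℂ)) {η : ℝ} (hη : η ≠ 0)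
    (u : Site 2) (ν : Measure (Set Coin)) [IsFiniteMeasure ν] (L : Set Coin) {i : Coin}
    (hi : edgeOf '' {vd : Site 2 × Fin 2 | i ∈ coinsOf k vd} ⊆ boxEdgesAt (ctr k u) k) :
    |ν.real {T | insert i (T ∪ L) ∈ coinEvent k m F η} -
        ν.real {T | (T ∪ L) \ {i} ∈ coinEvent k m F η}| ≤
      ν.real {T | cfg k (T ∪ L) ∈ Rel k m F η u k} := by
  have hE : MeasurableSet (coinEvent k m F η) := measurable_cfg k (measurableSet_Aloc m F hη)
  have hA : MeasurableSet {T : Set Coin | insert i (T ∪ L) ∈ coinEvent k m F η} :=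
    ((measurable_insert_pt i).comp (measurable_union_const_far L)) hE
  have hB : MeasurableSet {T : Set Coin | (T ∪ L) \ {i} ∈ coinEvent k m F η} :=
    ((measurable_sdiff_pt i).comp (measurable_union_const_far L)) hE
  refine (abs_measureReal_sub_le_measureReal_symmDiff hA.nullMeasurableSet hB.nullMeasurableSet).trans
    (measureReal_mono fun T hT => ?_)
  rw [Set.mem_symmDiff] at hT
  have hne : ¬ (insert i (T ∪ L) ∈ coinEvent k m F η ↔ (T ∪ L) \ {i} ∈ coinEvent k m F η) := by
    rcases hT with ⟨h1, h2⟩ | ⟨h1, h2⟩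
    · exact fun h => h2 (h.1 h1)
    · exact fun h => h2 (h.2 h1)
  exact IsPivotalOn.mono (isPivotalOn_cfg_of_not_iff k m F η hne) hi

/-! ## Bookkeeping -/

/-- `|a₂ · (½ X) − a₁ · (¼ Y)| ≤ (2|a₂| + κ|a₁|) ρ` whenever `|X| ≤ 4ρ` and `|Y| ≤ 4κρ`. -/
theorem abs_orbit_comb_le_of_abs_le {X Y ρ κ a₁ a₂ : ℝ} (hX : |X| ≤ 4 * ρ)
    (hY : |Y| ≤ 4 * (κ * ρ)) :
    |a₂ * ((1 / 2 : ℝ) * X) - a₁ * ((1 / 4 : ℝ) * Y)| ≤ (2 * |a₂| + κ * |a₁|) * ρ := by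
  have h2 : (0 : ℝ) < 1 / 2 := by norm_num
  have h4 : (0 : ℝ) < 1 / 4 := by norm_num
  calc |a₂ * ((1 / 2 : ℝ) * X) - a₁ * ((1 / 4 : ℝ) * Y)|
      ≤ |a₂ * ((1 / 2 : ℝ) * X)| + |a₁ * ((1 / 4 : ℝ) * Y)| := abs_sub _ _
    _ = |a₂| * ((1 / 2 : ℝ) * |X|) + |a₁| * ((1 / 4 : ℝ) * |Y|) := by
        rw [abs_mul, abs_mul, abs_mul, abs_mul, abs_of_pos h2, abs_of_pos h4]
    _ ≤ |a₂| * ((1 / 2 : ℝ) * (4 * ρ)) + |a₁| * ((1 / 4 : ℝ) * (4 * (κ * ρ))) := by gcongr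
    _ = (2 * |a₂| + κ * |a₁|) * ρ := by ring

/-! ## The bound for a general finite coin measure and far field -/

/-- **Conditional orbit sums ≤ constant × conditional relevance** (general form).  For every finite
measure `ν` on coin sets and every far field `L`, the `a₂, a₁`-combination of the conditional
`C₄`-orbit sums of the block of `u` (selector coins of the four bundles at `u`, weight `½`; own coins
of the interior edges of the four cells at `u`, weight `¼`) is at most
`(2|a₂| + 2k²|a₁|) · ν{T | cfg k (T ∪ L) ∈ Rel k m F η u k}`: every one of the `≤ 4` selector and
`≤ 4 · 2k²` interior coins is read inside the `k`-box about `k•u` (`image_selector_subset_boxEdgesAt`,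
`edgeOf_mem_boxEdgesAt_of_mem_interiorEdges`) and `abs_cond_infl_le_real_Rel` applies to each. -/
theorem abs_orbit_comb_cond_le_real_Rel {k : ℕ} (hk : 0 < k) (m : ℕ) (F : Fin m → Quad (univ : Set ℂ))
    {η : ℝ} (hη : η ≠ 0) (u : Site 2) (ν : Measure (Set Coin)) [IsFiniteMeasure ν] (L : Set Coin)
    (a₁ a₂ : ℝ) :
    |a₂ * ((1 / 2 : ℝ) * ∑ b ∈ bundlesAt u,
        (ν.real {T | insert (b.1, b.2, (2 : Fin 3)) (T ∪ L) ∈ coinEvent k m F η} -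
          ν.real {T | (T ∪ L) \ {(b.1, b.2, (2 : Fin 3))} ∈ coinEvent k m F η})) -
      a₁ * ((1 / 4 : ℝ) * ∑ t ∈ cellsAt u, ∑ e ∈ interiorEdges k t,
        (ν.real {T | insert (e.1, e.2, (0 : Fin 3)) (T ∪ L) ∈ coinEvent k m F η} -
          ν.real {T | (T ∪ L) \ {(e.1, e.2, (0 : Fin 3))} ∈ coinEvent k m F η}))| ≤
      (2 * |a₂| + 2 * (k : ℝ) ^ 2 * |a₁|) * ν.real {T | cfg k (T ∪ L) ∈ Rel k m F η u k} := by
  set ρ : ℝ := ν.real {T | cfg k (T ∪ L) ∈ Rel k m F η u k} with hρ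
  have hρ0 : 0 ≤ ρ := measureReal_nonneg
  refine abs_orbit_comb_le_of_abs_le ?_ ?_
  · refine (Finset.abs_sum_le_sum_abs _ _).trans ?_
    refine (Finset.sum_le_card_nsmul _ _ ρ fun b hb => ?_).trans ?_
    · exact abs_cond_infl_le_real_Rel k m F hη u ν L (image_selector_subset_boxEdgesAt hk hb)
    · rw [nsmul_eq_mul]
      gcongr
      exact_mod_cast card_bundlesAt_le u
  · refine (Finset.abs_sum_le_sum_abs _ _).trans ?_
    refine (Finset.sum_le_card_nsmul _ _ (2 * (k : ℝ) ^ 2 * ρ) fun t ht => ?_).trans ?_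
    · refine (Finset.abs_sum_le_sum_abs _ _).trans ?_
      refine (Finset.sum_le_card_nsmul _ _ ρ fun e he => ?_).trans ?_
      · refine abs_cond_infl_le_real_Rel k m F hη u ν L ?_
        rw [setOf_own_mem_coinsOf, Set.image_singleton, Set.singleton_subset_iff]
        exact edgeOf_mem_boxEdgesAt_of_mem_interiorEdges hk ht he
      · rw [nsmul_eq_mul]
        gcongr
        exact_mod_cast card_interiorEdges_le k t
    · rw [nsmul_eq_mul]
      gcongr
      exact_mod_cast card_cellsAt_le u

/-! ## The registered stub -/

/-- **Registered stub `localEngine_rateFree`** (rate-free normalisation bound of the local engine of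
line `far-field-is-a-quarter-turn`).  With `K = coinWindow k (boxEdgesAt (ctr k u) R)` the coins read
inside the `R`-box about the block centre `k•u`, `ν = (coinLaw k q).map (· ∩ K)` the law of the
configuration inside `K`, and the far field `S \ K` frozen, the `a₂, a₁`-combination of the
conditional `C₄`-orbit sums of the block of `u` is at most `(2|a₂| + 2k²|a₁|)` times the conditional
probability that the block's `k`-box is relevant (set-pivotal) for the localised joint crossing event
(`abs_orbit_comb_cond_le_real_Rel` with `L = S \ K`). -/
theorem localEngine_rateFree {k : ℕ} (hk : 0 < k) (m : ℕ) (F : Fin m → Quad (univ : Set ℂ)) {η : ℝ}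
    (hη : η ≠ 0) (q : ℝ × ℝ) (u : Site 2) (R : ℕ) (S : Set Coin) (a₁ a₂ : ℝ) :
    (fun (K : Set Coin) (ν : Measure (Set Coin)) =>
      |a₂ * ((1 / 2 : ℝ) * ∑ b ∈ bundlesAt u,
          (ν.real {T | insert (b.1, b.2, (2 : Fin 3)) (T ∪ (S \ K)) ∈ coinEvent k m F η} -
            ν.real {T | (T ∪ (S \ K)) \ {(b.1, b.2, (2 : Fin 3))} ∈ coinEvent k m F η})) -
        a₁ * ((1 / 4 : ℝ) * ∑ t ∈ cellsAt u, ∑ e ∈ interiorEdges k t,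
          (ν.real {T | insert (e.1, e.2, (0 : Fin 3)) (T ∪ (S \ K)) ∈ coinEvent k m F η} -
            ν.real {T | (T ∪ (S \ K)) \ {(e.1, e.2, (0 : Fin 3))} ∈ coinEvent k m F η}))| ≤
        (2 * |a₂| + 2 * (k : ℝ) ^ 2 * |a₁|) * ν.real {T | cfg k (T ∪ (S \ K)) ∈ Rel k m F η u k})
      (coinWindow k (boxEdgesAt (ctr k u) R))
      ((coinLaw k q).map (fun T => T ∩ coinWindow k (boxEdgesAt (ctr k u) R))) := by
  dsimp only
  exact abs_orbit_comb_cond_le_real_Rel hk m F hη u _ _ a₁ a₂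

end Summit.CriticalPhenomena.CardyFormulaZ2.Theorems.CardySelfRefinement.FarField

end
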